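import Mathlib
import Literature.Analysis.PDE.Wave1DExteriorEnergy
import Literature.Analysis.PDE.InverseSquareCorrectedTowers
import HarnessLib

/-!
# `t`-polynomials with decaying coefficients carry no far channel energy

Analysis/PDE support file (everything proved, no definitions).
* `tpoly_energy_pointwise`: if `p(t,z) = Σ_{i<N} a_i(z) tⁱ` beyond `z ≥ x₁ ≥ 1` with
  `|a_i| ≤ L z^{−i}`, `|a_i'| ≤ L z^{−i−1}` and `W ≤ W₀ z⁻²` there, then the energy density
  `p_t² + p_z² + W p²` is `≤ N²L²(N² + 1 + W₀) z⁻²` on `{z ≥ x₁, |t| ≤ z}`;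
* `wave1D_farEnergy_tendsto_zero_base`: a `C²` function whose energy density is `≤ C z⁻²` on the
  far cone `{z > ρ + |t|}` (`ρ ≥ 1`) has far energy `∫_{z>ρ+|t|} e ≤ C/(ρ+|t|) → 0` as `t → ±∞`
  (the base-`ρ` form of `Wave1DNonRadiating.lean`);
* `correctedTower_farEnergy_tendsto_zero`: hence every tower `Σ_i binom(m,i) ẽ_{m−i} tⁱ` of a chain
  with `|ẽ_k| ≤ C_e z^{k−ℓ}`, `|ẽ_k'| ≤ C_e z^{k−ℓ−1}` (`m ≤ ℓ`) has vanishing far channel energy on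
  every cone based at `ρ ≥ x₁`.
This is why the true `t`-polynomial kernel elements of the far-side channel estimate of
`FixedModeChannels` (route PhotonSphereChannels, stmt-FinalStateConjecture-10048) are invisible to the
right-hand side of the channel inequality (Kenig–Lawrie–Liu–Schlag 2015, §1, for the exact ones).
Folklore.
-/

noncomputable section

namespace Literature.Analysis.PDE

open MeasureTheory Set Filter Topology Finset Real

/-! ### Pointwise energy bound for `t`-polynomials -/

/-- **Pointwise energy decay of a `t`-polynomial with decaying coefficients.** See the module
docstring. [folklore] -/
theorem tpoly_energy_pointwise {W : ℝ → ℝ} {p : ℝ → ℝ → ℝ} {a : ℕ → ℝ → ℝ} {N : ℕ}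
    {x₁ L W₀ : ℝ} (hx₁ : 1 ≤ x₁) (hL : 0 ≤ L) (hW₀ : 0 ≤ W₀)
    (hp : ∀ t z, x₁ ≤ z → p t z = ∑ i ∈ range N, a i z * t ^ i)
    (hpt : ∀ t z, x₁ ≤ z → deriv (fun τ => p τ z) t = ∑ i ∈ range N, a i z * ((i : ℝ) * t ^ (i - 1)))
    (hpz : ∀ t z, x₁ ≤ z → deriv (p t) z = ∑ i ∈ range N, deriv (a i) z * t ^ i)
    (ha : ∀ i, i < N → ∀ z, x₁ ≤ z → |a i z| ≤ L * z ^ (-(i : ℝ)))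
    (ha' : ∀ i, i < N → ∀ z, x₁ ≤ z → |deriv (a i) z| ≤ L * z ^ (-(i : ℝ) - 1))
    (hW : ∀ z, x₁ ≤ z → W z ≤ W₀ * z ^ (-(2 : ℝ))) :
    ∀ t z, x₁ ≤ z → |t| ≤ z →
      deriv (fun τ => p τ z) t ^ 2 + deriv (p t) z ^ 2 + W z * p t z ^ 2
        ≤ ((N : ℝ) ^ 2 * L ^ 2 * ((N : ℝ) ^ 2 + 1 + W₀)) * z ^ (-(2 : ℝ)) := by
  intro t z hz htz
  have hz1 : 1 ≤ z := hx₁.trans hz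
  have hz0 : 0 < z := by linarith
  have ht0 : 0 ≤ |t| := abs_nonneg t
  have hpowt : ∀ k : ℕ, |t| ^ k ≤ z ^ k := fun k => pow_le_pow_left₀ ht0 htz k
  have hzi : ∀ i : ℕ, z ^ (-(i : ℝ)) * z ^ i = 1 := fun i => by
    rw [← Real.rpow_natCast z i, ← Real.rpow_add hz0]; simp
  -- `|p| ≤ N L`
  have hp_bd : |p t z| ≤ (N : ℝ) * L := by
    rw [hp t z hz]
    calc |∑ i ∈ range N, a i z * t ^ i| ≤ ∑ i ∈ range N, |a i z * t ^ i| := abs_sum_le_sum_abs _ _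
      _ ≤ ∑ i ∈ range N, L := by
          refine Finset.sum_le_sum fun i hi => ?_
          have hiN := mem_range.1 hi
          rw [abs_mul, abs_pow]
          calc |a i z| * |t| ^ i ≤ (L * z ^ (-(i : ℝ))) * z ^ i :=
                mul_le_mul (ha i hiN z hz) (hpowt i) (by positivity) (by positivity)
            _ = L * (z ^ (-(i : ℝ)) * z ^ i) := by ring
            _ = L := by rw [hzi, mul_one]
      _ = (N : ℝ) * L := by rw [Finset.sum_const, Finset.card_range, nsmul_eq_mul]
  -- `|p_z| ≤ N L z⁻¹`
  have hpz_bd : |deriv (p t) z| ≤ (N : ℝ) * L * z ^ (-(1 : ℝ)) := by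
    rw [hpz t z hz]
    calc |∑ i ∈ range N, deriv (a i) z * t ^ i| ≤ ∑ i ∈ range N, |deriv (a i) z * t ^ i| :=
          abs_sum_le_sum_abs _ _
      _ ≤ ∑ i ∈ range N, L * z ^ (-(1 : ℝ)) := by
          refine Finset.sum_le_sum fun i hi => ?_
          have hiN := mem_range.1 hi
          rw [abs_mul, abs_pow]
          calc |deriv (a i) z| * |t| ^ i ≤ (L * z ^ (-(i : ℝ) - 1)) * z ^ i :=
                mul_le_mul (ha' i hiN z hz) (hpowt i) (by positivity) (by positivity)
            _ = L * z ^ (-(1 : ℝ)) * (z ^ (-(i : ℝ)) * z ^ i) := by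
                rw [show -(i : ℝ) - 1 = -(1 : ℝ) + -(i : ℝ) by ring, Real.rpow_add hz0]; ring
            _ = L * z ^ (-(1 : ℝ)) := by rw [hzi, mul_one]
      _ = (N : ℝ) * L * z ^ (-(1 : ℝ)) := by rw [Finset.sum_const, Finset.card_range, nsmul_eq_mul]; ring
  -- `|p_t| ≤ N² L z⁻¹`
  have hpt_bd : |deriv (fun τ => p τ z) t| ≤ (N : ℝ) ^ 2 * L * z ^ (-(1 : ℝ)) := by
    rw [hpt t z hz]
    calc |∑ i ∈ range N, a i z * ((i : ℝ) * t ^ (i - 1))|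
        ≤ ∑ i ∈ range N, |a i z * ((i : ℝ) * t ^ (i - 1))| := abs_sum_le_sum_abs _ _
      _ ≤ ∑ i ∈ range N, (N : ℝ) * L * z ^ (-(1 : ℝ)) := by
          refine Finset.sum_le_sum fun i hi => ?_
          have hiN := mem_range.1 hi
          have hiN' : (i : ℝ) ≤ N := by exact_mod_cast hiN.le
          rcases Nat.eq_zero_or_pos i with hi0 | hipos
          · subst hi0; simp; positivity
          · rw [abs_mul, abs_mul, abs_pow, Nat.abs_cast]
            have hti : |t| ^ (i - 1) ≤ z ^ (i - 1) := hpowt _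
            have hzz : z ^ (-(i : ℝ)) * z ^ (i - 1) = z ^ (-(1 : ℝ)) := by
              rw [← Real.rpow_natCast z (i - 1), ← Real.rpow_add hz0, Nat.cast_sub hipos]
              congr 1; push_cast; ring
            calc |a i z| * ((i : ℝ) * |t| ^ (i - 1)) ≤ (L * z ^ (-(i : ℝ))) * ((N : ℝ) * z ^ (i - 1)) := by
                  refine mul_le_mul (ha i hiN z hz) ?_ (by positivity) (by positivity)
                  exact mul_le_mul hiN' hti (by positivity) (by positivity)
              _ = (N : ℝ) * L * (z ^ (-(i : ℝ)) * z ^ (i - 1)) := by ring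
              _ = (N : ℝ) * L * z ^ (-(1 : ℝ)) := by rw [hzz]
      _ = (N : ℝ) ^ 2 * L * z ^ (-(1 : ℝ)) := by rw [Finset.sum_const, Finset.card_range, nsmul_eq_mul]; ring
  -- squares and the potential term
  have hz2 : (z ^ (-(1 : ℝ))) ^ 2 = z ^ (-(2 : ℝ)) := by
    rw [← Real.rpow_natCast, ← Real.rpow_mul hz0.le]; norm_num
  have hz20 : 0 ≤ z ^ (-(2 : ℝ)) := Real.rpow_nonneg hz0.le _
  have e1 : deriv (fun τ => p τ z) t ^ 2 ≤ ((N : ℝ) ^ 2 * L) ^ 2 * z ^ (-(2 : ℝ)) := by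
    calc deriv (fun τ => p τ z) t ^ 2 = |deriv (fun τ => p τ z) t| ^ 2 := (sq_abs _).symm
      _ ≤ ((N : ℝ) ^ 2 * L * z ^ (-(1 : ℝ))) ^ 2 := pow_le_pow_left₀ (abs_nonneg _) hpt_bd 2
      _ = ((N : ℝ) ^ 2 * L) ^ 2 * z ^ (-(2 : ℝ)) := by rw [mul_pow, hz2]
  have e2 : deriv (p t) z ^ 2 ≤ ((N : ℝ) * L) ^ 2 * z ^ (-(2 : ℝ)) := by
    calc deriv (p t) z ^ 2 = |deriv (p t) z| ^ 2 := (sq_abs _).symm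
      _ ≤ ((N : ℝ) * L * z ^ (-(1 : ℝ))) ^ 2 := pow_le_pow_left₀ (abs_nonneg _) hpz_bd 2
      _ = ((N : ℝ) * L) ^ 2 * z ^ (-(2 : ℝ)) := by rw [mul_pow, hz2]
  have e3 : W z * p t z ^ 2 ≤ (W₀ * z ^ (-(2 : ℝ))) * ((N : ℝ) * L) ^ 2 := by
    calc W z * p t z ^ 2 = W z * |p t z| ^ 2 := by rw [sq_abs]
      _ ≤ (W₀ * z ^ (-(2 : ℝ))) * ((N : ℝ) * L) ^ 2 :=
          mul_le_mul (hW z hz) (pow_le_pow_left₀ (abs_nonneg _) hp_bd 2) (by positivity) (by positivity)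
  calc deriv (fun τ => p τ z) t ^ 2 + deriv (p t) z ^ 2 + W z * p t z ^ 2
      ≤ ((N : ℝ) ^ 2 * L) ^ 2 * z ^ (-(2 : ℝ)) + ((N : ℝ) * L) ^ 2 * z ^ (-(2 : ℝ))
        + (W₀ * z ^ (-(2 : ℝ))) * ((N : ℝ) * L) ^ 2 := add_le_add_three e1 e2 e3
    _ = ((N : ℝ) ^ 2 * L ^ 2 * ((N : ℝ) ^ 2 + 1 + W₀)) * z ^ (-(2 : ℝ)) := by ring

/-! ### Far energy `→ 0` from a `z⁻²` bound on the cone based at `ρ` -/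

/-- **Far energy of a non-radiating function, cone based at `ρ ≥ 1`.** If the energy density of a
`C²` function is `≤ C z⁻²` on `{z > ρ + |t|}` (`W ≥ 0` continuous) then it is integrable there,
`∫_{z>ρ+|t|} e ≤ C/(ρ+|t|)`, and the far energy tends to `0` as `t → ±∞`. [folklore] -/
theorem wave1D_farEnergy_tendsto_zero_base {W : ℝ → ℝ} {φ : ℝ → ℝ → ℝ} (hW : Continuous W)
    (hW0 : ∀ z, 0 ≤ W z) (hφ : ContDiff ℝ 2 (Function.uncurry φ)) {ρ C : ℝ} (hρ : 1 ≤ ρ)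
    (hbd : ∀ t z, ρ + |t| < z →
      deriv (fun τ => φ τ z) t ^ 2 + deriv (φ t) z ^ 2 + W z * φ t z ^ 2 ≤ C * z ^ (-(2 : ℝ))) :
    (∀ t, IntegrableOn (fun z => deriv (fun τ => φ τ z) t ^ 2 + deriv (φ t) z ^ 2 + W z * φ t z ^ 2)
        (Ioi (ρ + |t|))) ∧
    (∀ t, (∫ z in Ioi (ρ + |t|),
        (deriv (fun τ => φ τ z) t ^ 2 + deriv (φ t) z ^ 2 + W z * φ t z ^ 2)) ≤ C / (ρ + |t|)) ∧
    Tendsto (fun t => ∫ z in Ioi (ρ + |t|),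
        (deriv (fun τ => φ τ z) t ^ 2 + deriv (φ t) z ^ 2 + W z * φ t z ^ 2)) atTop (𝓝 0) ∧
    Tendsto (fun t => ∫ z in Ioi (ρ + |t|),
        (deriv (fun τ => φ τ z) t ^ 2 + deriv (φ t) z ^ 2 + W z * φ t z ^ 2)) atBot (𝓝 0) := by
  have hcont : ∀ t, Continuous fun z =>
      deriv (fun τ => φ τ z) t ^ 2 + deriv (φ t) z ^ 2 + W z * φ t z ^ 2 := fun t =>
    (continuous_wave1D_energyDensity hW hφ).comp (continuous_const.prodMk continuous_id)
  have hnn : ∀ t z, 0 ≤ deriv (fun τ => φ τ z) t ^ 2 + deriv (φ t) z ^ 2 + W z * φ t z ^ 2 :=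
    fun t z => wave1D_energyDensity_nonneg hW0 t z
  have hedge : ∀ t : ℝ, (0 : ℝ) < ρ + |t| := fun t => by positivity
  have hmaj : ∀ t : ℝ, IntegrableOn (fun z : ℝ => C * z ^ (-(2 : ℝ))) (Ioi (ρ + |t|)) := fun t =>
    (integrableOn_Ioi_rpow_of_lt (by norm_num) (hedge t)).const_mul C
  have hint : ∀ t, IntegrableOn (fun z => deriv (fun τ => φ τ z) t ^ 2 + deriv (φ t) z ^ 2
      + W z * φ t z ^ 2) (Ioi (ρ + |t|)) := fun t =>
    Integrable.mono' (hmaj t) (hcont t).aestronglyMeasurable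
      ((ae_restrict_iff' measurableSet_Ioi).2 (ae_of_all _ fun z hz => by
        rw [Real.norm_eq_abs, abs_of_nonneg (hnn t z)]; exact hbd t z hz))
  have hle : ∀ t, (∫ z in Ioi (ρ + |t|), (deriv (fun τ => φ τ z) t ^ 2 + deriv (φ t) z ^ 2
      + W z * φ t z ^ 2)) ≤ C / (ρ + |t|) := by
    intro t
    calc (∫ z in Ioi (ρ + |t|), (deriv (fun τ => φ τ z) t ^ 2 + deriv (φ t) z ^ 2
          + W z * φ t z ^ 2))
        ≤ ∫ z in Ioi (ρ + |t|), C * z ^ (-(2 : ℝ)) :=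
          setIntegral_mono_on (hint t) (hmaj t) measurableSet_Ioi fun z hz => hbd t z hz
      _ = C * (-(ρ + |t|) ^ (-(2 : ℝ) + 1) / (-(2 : ℝ) + 1)) := by
          rw [MeasureTheory.integral_const_mul, integral_Ioi_rpow_of_lt (by norm_num) (hedge t)]
      _ = C / (ρ + |t|) := by
          rw [show -(2 : ℝ) + 1 = -1 by norm_num, rpow_neg_one]
          field_simp
  have hnn' : ∀ t, 0 ≤ ∫ z in Ioi (ρ + |t|), (deriv (fun τ => φ τ z) t ^ 2 + deriv (φ t) z ^ 2
      + W z * φ t z ^ 2) := fun t => setIntegral_nonneg measurableSet_Ioi fun z _ => hnn t z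
  have habs : ∀ {l : Filter ℝ}, Tendsto (fun t : ℝ => |t|) l atTop →
      Tendsto (fun t => C / (ρ + |t|)) l (𝓝 0) := fun h =>
    tendsto_const_nhds.div_atTop (tendsto_atTop_add_const_left _ _ h)
  have hsq : ∀ {l : Filter ℝ}, Tendsto (fun t : ℝ => |t|) l atTop →
      Tendsto (fun t => ∫ z in Ioi (ρ + |t|), (deriv (fun τ => φ τ z) t ^ 2 + deriv (φ t) z ^ 2
        + W z * φ t z ^ 2)) l (𝓝 0) := fun h =>
    squeeze_zero (fun t => hnn' t) (fun t => hle t) (habs h)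
  exact ⟨hint, hle, hsq tendsto_abs_atTop_atTop, hsq tendsto_abs_atBot_atTop⟩

/-! ### Towers of a corrected chain -/

/-- **Towers carry no far channel energy.** For a chain `ẽ_0, …, ẽ_ℓ` (`C²`, with
`|ẽ_k| ≤ C_e z^{k−ℓ}`, `|ẽ_k'| ≤ C_e z^{k−ℓ−1}` for `z ≥ x₁`, `x₁ ≥ 1`), a potential
`0 ≤ W ≤ W₀ z⁻²` on `z ≥ x₁` (continuous, `W ≥ 0` everywhere) and `m ≤ ℓ`, the tower
`p_m = Σ_i binom(m,i) ẽ_{m−i} tⁱ` has far energy `→ 0` as `t → ±∞` on every cone based at `ρ ≥ x₁`,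
with the explicit bound `∫_{z>ρ+|t|} e[p_m](t,·) ≤ C/(ρ + |t|)`. [folklore] -/
theorem correctedTower_farEnergy_tendsto_zero {W : ℝ → ℝ} {E : ℕ → ℝ → ℝ} {ℓ m : ℕ}
    {x₁ Ce W₀ : ℝ} (hW : Continuous W) (hW0 : ∀ z, 0 ≤ W z) (hx₁ : 1 ≤ x₁) (hCe : 0 ≤ Ce)
    (hW₀ : 0 ≤ W₀) (hWb : ∀ z, x₁ ≤ z → W z ≤ W₀ * z ^ (-(2 : ℝ)))
    (hC : ∀ j, j ≤ ℓ → ContDiff ℝ 2 (E j)) (hm : m ≤ ℓ)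
    (hEb : ∀ k, k ≤ ℓ → ∀ z, x₁ ≤ z →
      |E k z| ≤ Ce * z ^ ((k : ℝ) - ℓ) ∧ |deriv (E k) z| ≤ Ce * z ^ ((k : ℝ) - ℓ - 1))
    {ρ : ℝ} (hρ : x₁ ≤ ρ) :
    ∃ C : ℝ, (∀ t, IntegrableOn (fun z =>
        deriv (fun τ => ∑ i ∈ range (m + 1), (m.choose i : ℝ) * E (m - i) z * τ ^ i) t ^ 2
          + deriv (fun y => ∑ i ∈ range (m + 1), (m.choose i : ℝ) * E (m - i) y * t ^ i) z ^ 2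
          + W z * (∑ i ∈ range (m + 1), (m.choose i : ℝ) * E (m - i) z * t ^ i) ^ 2)
        (Ioi (ρ + |t|))) ∧
      (∀ t, (∫ z in Ioi (ρ + |t|),
        (deriv (fun τ => ∑ i ∈ range (m + 1), (m.choose i : ℝ) * E (m - i) z * τ ^ i) t ^ 2
          + deriv (fun y => ∑ i ∈ range (m + 1), (m.choose i : ℝ) * E (m - i) y * t ^ i) z ^ 2
          + W z * (∑ i ∈ range (m + 1), (m.choose i : ℝ) * E (m - i) z * t ^ i) ^ 2))
        ≤ C / (ρ + |t|)) ∧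
      Tendsto (fun t => ∫ z in Ioi (ρ + |t|),
        (deriv (fun τ => ∑ i ∈ range (m + 1), (m.choose i : ℝ) * E (m - i) z * τ ^ i) t ^ 2
          + deriv (fun y => ∑ i ∈ range (m + 1), (m.choose i : ℝ) * E (m - i) y * t ^ i) z ^ 2
          + W z * (∑ i ∈ range (m + 1), (m.choose i : ℝ) * E (m - i) z * t ^ i) ^ 2))
        atTop (𝓝 0) ∧
      Tendsto (fun t => ∫ z in Ioi (ρ + |t|),
        (deriv (fun τ => ∑ i ∈ range (m + 1), (m.choose i : ℝ) * E (m - i) z * τ ^ i) t ^ 2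
          + deriv (fun y => ∑ i ∈ range (m + 1), (m.choose i : ℝ) * E (m - i) y * t ^ i) z ^ 2
          + W z * (∑ i ∈ range (m + 1), (m.choose i : ℝ) * E (m - i) z * t ^ i) ^ 2))
        atBot (𝓝 0) := by
  set p : ℝ → ℝ → ℝ := fun t z => ∑ i ∈ range (m + 1), (m.choose i : ℝ) * E (m - i) z * t ^ i
    with hp
  have hpC : ContDiff ℝ 2 (Function.uncurry p) := correctedTower_contDiff hC hm
  -- coefficient bounds `|binom ẽ_{m−i}| ≤ 2^m C_e z^{-i}`
  set L : ℝ := (2 : ℝ) ^ m * Ce with hL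
  have hL0 : 0 ≤ L := by positivity
  have hchoose : ∀ i, (m.choose i : ℝ) ≤ (2 : ℝ) ^ m := fun i => by
    exact_mod_cast (Nat.choose_le_two_pow m i)
  have ha : ∀ i, i < m + 1 → ∀ z, x₁ ≤ z →
      |(m.choose i : ℝ) * E (m - i) z| ≤ L * z ^ (-(i : ℝ)) := by
    intro i hi z hz
    have hz1 : 1 ≤ z := hx₁.trans hz
    have hz0 : 0 < z := by linarith
    have hb := (hEb (m - i) (by omega) z hz).1
    rw [abs_mul, abs_of_nonneg (Nat.cast_nonneg _)]
    have hexp : z ^ (((m - i : ℕ) : ℝ) - ℓ) ≤ z ^ (-(i : ℝ)) := by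
      refine Real.rpow_le_rpow_of_exponent_le hz1 ?_
      rw [Nat.cast_sub (by omega)]
      have : (m : ℝ) ≤ ℓ := by exact_mod_cast hm
      linarith
    calc (m.choose i : ℝ) * |E (m - i) z| ≤ (2 : ℝ) ^ m * (Ce * z ^ (-(i : ℝ))) :=
          mul_le_mul (hchoose i) (hb.trans (mul_le_mul_of_nonneg_left hexp hCe)) (abs_nonneg _)
            (by positivity)
      _ = L * z ^ (-(i : ℝ)) := by rw [hL]; ring
  have ha' : ∀ i, i < m + 1 → ∀ z, x₁ ≤ z →
      |deriv (fun y => (m.choose i : ℝ) * E (m - i) y) z| ≤ L * z ^ (-(i : ℝ) - 1) := by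
    intro i hi z hz
    have hz1 : 1 ≤ z := hx₁.trans hz
    have hz0 : 0 < z := by linarith
    have hb := (hEb (m - i) (by omega) z hz).2
    rw [deriv_const_mul _ ((hC (m - i) (by omega)).differentiable (by norm_num) z), abs_mul,
      abs_of_nonneg (Nat.cast_nonneg _)]
    have hexp : z ^ (((m - i : ℕ) : ℝ) - ℓ - 1) ≤ z ^ (-(i : ℝ) - 1) := by
      refine Real.rpow_le_rpow_of_exponent_le hz1 ?_
      rw [Nat.cast_sub (by omega)]
      have : (m : ℝ) ≤ ℓ := by exact_mod_cast hm
      linarith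
    calc (m.choose i : ℝ) * |deriv (E (m - i)) z| ≤ (2 : ℝ) ^ m * (Ce * z ^ (-(i : ℝ) - 1)) :=
          mul_le_mul (hchoose i) (hb.trans (mul_le_mul_of_nonneg_left hexp hCe)) (abs_nonneg _)
            (by positivity)
      _ = L * z ^ (-(i : ℝ) - 1) := by rw [hL]; ring
  -- the pointwise bound
  have hpt := tpoly_energy_pointwise (W := W) (p := p) (a := fun i z => (m.choose i : ℝ) * E (m - i) z)
    (N := m + 1) hx₁ hL0 hW₀ (fun t z _ => by simp only [hp])
    (fun t z _ => by
      simp only [hp]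
      rw [(correctedTower_derivs hC hm t z).1])
    (fun t z _ => by
      simp only [hp]
      rw [(correctedTower_derivs hC hm t z).2]
      refine sum_congr rfl fun i hi => ?_
      rw [deriv_const_mul _ ((hC (m - i) (by
        have := mem_range.1 hi; omega)).differentiable (by norm_num) z)])
    ha ha' hWb
  set C : ℝ := ((m + 1 : ℕ) : ℝ) ^ 2 * L ^ 2 * (((m + 1 : ℕ) : ℝ) ^ 2 + 1 + W₀) with hCdef
  have hbd : ∀ t z, ρ + |t| < z →
      deriv (fun τ => p τ z) t ^ 2 + deriv (p t) z ^ 2 + W z * p t z ^ 2 ≤ C * z ^ (-(2 : ℝ)) := by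
    intro t z hz
    have ht0 : 0 ≤ |t| := abs_nonneg t
    exact hpt t z (by linarith) (by linarith)
  obtain ⟨h1, h2, h3, h4⟩ := wave1D_farEnergy_tendsto_zero_base hW hW0 hpC (hx₁.trans hρ) hbd
  exact ⟨C, h1, h2, h3, h4⟩

end Literature.Analysis.PDE
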